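import Literature.Geometry.Lorentzian.CorrespondingBoundaryExtensionPrep
import Literature.Geometry.Lorentzian.LocalTimeSeparation
import HarnessLib

/-!
# Extension of the isometric embedding of a common development across a corresponding boundary
# point (Sbierski 2016, §3.2, Lemma 14 "ExtendIso")

J. Sbierski, *On the existence of a maximal Cauchy development for the Einstein equations: a
dezornification*, Ann. Henri Poincaré 17 (2016) 301–329 = arXiv:1309.7591v3, §3.2, Lemma 14:

> *Let `U` be a CGHD of `M` and `M'` with isometric embedding `ψ : U ⊆ M → M'`. Then the set
> `C` [of boundary points of `U` having a corresponding boundary point] is open in `∂U` and the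
> isometric embedding `ψ : U → M'` extends smoothly to `ψ : U ∪ C → M'`.*

**Theorem (`LorentzianMetric.exists_extension_of_corresponding_future`), pure causal form, for a
boundary point to the future of the Cauchy hypersurface.** Let `(M, g, τ)`, `(M', g', τ')` be
strongly causal time-oriented Lorentzian manifolds of the same dimension, `Σ` a Cauchy
hypersurface of `M`, `U ⊆ M` open with `Σ ∩ U` a Cauchy hypersurface of `(U, g|_U, τ|_U)`,
`ψ : (U, g|_U) → M'` an isometric immersion with a chosen extension `Ψ : M → M'` (`Ψ = ψ` on `U`)
carrying future timelike curves of `U` to future timelike curves of `M'`, and let `p ∈ ∂U ∩ I⁺(Σ)`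
and `p' ∈ M'` be such that `Ψ ∘ γ → p'` for every future timelike curve `γ` of `U` converging to
`p` (for a common globally hyperbolic development and a pair of corresponding boundary points
this is Sbierski's Prop. 13 (ii), `IsCorrespondingPair.tendsto_glue`; strong causality and the
Cauchy property are theorems over the tree's Cauchy developments). Then there are an open `W ∋ p`
inside `I⁺(Σ)` and a map `Φ : M → M'`, `C^∞` on `W`, with `Φ = ψ` on `W ∩ U`, `Φ p = p'`, `dΦ_p`
injective, and such that every `q ∈ W ∩ ∂U` is the limit of a future timelike curve of `U` whose
image under `Ψ` converges to `Φ q` — so `q` and `Φ q` correspond (Prop. 13 (iii) ⇒ (i)): **`C` is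
open in `∂U`**, and `Φ` is the smooth extension with injective differential at `p` required by
the restart of the local uniqueness theorem (the hypothesis `(H4)` of
`Summit.FinalStateConjecture.….SubdataDevelopmentsEmbed.restart_of_locallyUnique`).

Proof, following the printed one in uniformly normal neighbourhoods (`exists_twoPoint_expInverse`)
of `p` and `p'` with causally convex neighbourhoods `A ∋ p`, `A' ∋ p'` inside them (strong
causality, `IsStronglyCausal.exists_causallyConvex_nhds`): a point `o ≪ p` of `U ∩ A` with
`Ψ o ∈ A'` is chosen on a timelike curve of `U` approaching `p` (its image approaches `p'`); the
radial vector `X = exp_o⁻¹ p` is future timelike (`isTimelike_expInverse_of_curve`), the radial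
geodesic `c` from `o` to `p` runs in `U` before `p` (`radial_mem_opens_of_mem_closure`), `Ψ ∘ c`
is the radial geodesic of `M'` from `o' = ψ o` with velocity `X' = dψ_o X`
(`expMap_smul_mfderiv_eq`), stays in `A'` by causal convexity and converges to `p'`, whence
`exp_{o'} X' = p'` and `exp_{o'}⁻¹ p' = X'` (`twoPoint_expInverse_eq_of_tendsto_radial`). Put
`Φ = exp_{o'} ∘ dψ_o ∘ exp_o⁻¹` on the open set `W` of points of `I⁺(Σ)` in the normal
neighbourhood of `p` whose radial vector from `o` is future timelike and is mapped by `dψ_o` into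
`𝓔_{o'}`: `Φ` is smooth, agrees with `ψ` on `W ∩ U` (the radial geodesic to a point of `U` lies in
`U` and the exponential maps commute with `ψ`), `Φ p = p'`, `dΦ_p = d(exp_{o'})_{X'} ∘ dψ_o ∘
d(exp_o⁻¹)_p` is injective (`injective_mfderiv_of_comp_eventuallyEq_id`), and for `q ∈ W ∩ ∂U`
the radial geodesic from `o` to `q` is a timelike curve of `U` whose image, the radial geodesic of
`M'` with velocity `dψ_o (exp_o⁻¹ q) ∈ 𝓔_{o'}`, converges to `Φ q`.

Everything is proved; no definitions, no named facts (D-0026). The time-dual statement (boundary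
points to the past of `Σ`) and the instance for common globally hyperbolic developments are
derived downstream.

## References

* J. Sbierski, Ann. Henri Poincaré 17 (2016) 301–329 = arXiv:1309.7591v3, §3.2, Lemma 14,
  Prop. 13 (arXiv numbering). [Sbierski2016AHP]
* B. O'Neill, *Semi-Riemannian geometry with applications to relativity*, Academic Press 1983,
  Ch. 3, pp. 90–91; Ch. 5, Lemma 5.33, Prop. 5.34; Ch. 14, p. 437 (strong causality).
  [ONeillSemiRiemannian1983]
* H. Ringström, *The Cauchy Problem in General Relativity*, EMS 2009, Ch. 23. [Ringstrom2009]
-/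

noncomputable section

open Bundle Set Filter Function Metric TopologicalSpace Topology
open scoped Manifold ContDiff Topology

namespace Literature.Geometry.Lorentzian

open Literature.Geometry.Riemannian

section Core

variable {d : ℕ} {M : Type*} [TopologicalSpace M] [ChartedSpace (EuclideanSpace ℝ (Fin d)) M]
  [IsManifold (𝓡 d) ∞ M] [T2Space M] [SecondCountableTopology M]
  {M' : Type*} [TopologicalSpace M'] [ChartedSpace (EuclideanSpace ℝ (Fin d)) M']
  [IsManifold (𝓡 d) ∞ M'] [T2Space M']

namespace LorentzianMetric

variable {g : LorentzianMetric (𝓡 d) ∞ M} [g.HasLeviCivita]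
  [CovariantDerivative.ContMDiffCovariantDerivative g.leviCivita 1] (τ : TimeOrientation g)
  {g' : LorentzianMetric (𝓡 d) ∞ M'} [g'.HasLeviCivita]
  [CovariantDerivative.ContMDiffCovariantDerivative g'.leviCivita 1] (τ' : TimeOrientation g')

/-- **Sbierski's Lemma 14 (extension of `ψ` across a corresponding boundary point), future case,
pure form.** Let `(M, g, τ)`, `(M', g', τ')` be strongly causal time-oriented Lorentzian manifolds
of the same dimension, `Σ` a Cauchy hypersurface of `M`, `U ⊆ M` open with `Σ ∩ U` a Cauchy
hypersurface of `(U, g|_U, τ|_U)`, `ψ : (U, g|_U) → M'` an isometric immersion with a chosen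
extension `Ψ : M → M'` (`Ψ = ψ` on `U`) carrying future timelike curves of `U` to future timelike
curves, and let `p ∈ ∂U ∩ I⁺(Σ)`, `p' ∈ M'` be such that `Ψ ∘ γ → p'` for every future timelike
curve `γ` of `U` converging to `p` (Sbierski's Prop. 13 (ii) for a pair of corresponding boundary
points). Then there are an open `W ∋ p` inside `I⁺(Σ)` and a map `Φ : M → M'`, `C^∞` on `W`, with
`Φ = ψ` on `W ∩ U`, `Φ p = p'`, `dΦ_p` injective, and such that every `q ∈ W ∩ ∂U` is the limit
of a future timelike curve of `U` whose image under `Ψ` converges to `Φ q` (so that `q` and `Φ q`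
correspond, Prop. 13 (iii) ⇒ (i): `C` is open in `∂U`). Construction as printed:
`Φ = exp_{ψ o} ∘ dψ_o ∘ exp_o⁻¹` for a point `o ≪ p` of `U` close to `p`, on the set `W` of points
`q` of a uniformly normal neighbourhood of `p` whose radial vector `exp_o⁻¹ q` is future timelike
(then the radial geodesic from `o` to `q ∈ Ū` runs in `U`, by the causal convexity of `U`, and the
exponential maps commute with `ψ`); that `exp_{ψ o} (dψ_o (exp_o⁻¹ p)) = p'` is
`twoPoint_expInverse_eq_of_tendsto_radial` in a uniformly normal neighbourhood of `p'`.
[cite: Sbierski2016AHP, §3.2, Lemma 14 and its proof (arXiv numbering)]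
[cite: ONeillSemiRiemannian1983, Ch. 3, pp. 90–91; Ch. 5, Lemma 5.33] -/
theorem exists_extension_of_corresponding_future (U : Opens M)
    [(g.toPseudoRiemannianMetric.restrict PseudoRiemannianMetric.contMDiff_restrict_holds U).HasLeviCivita]
    [CovariantDerivative.ContMDiffCovariantDerivative
      (g.toPseudoRiemannianMetric.restrict PseudoRiemannianMetric.contMDiff_restrict_holds U).leviCivita 1]
    {Sig : Set M} (hSig : g.IsCauchyHypersurface τ Sig)
    (hU : (g.restrict PseudoRiemannianMetric.contMDiff_restrict_holds U).IsCauchyHypersurface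
      (τ.restrict PseudoRiemannianMetric.contMDiff_restrict_holds τ.contMDiff_restrict_holds U)
      (Subtype.val ⁻¹' Sig))
    (hSC : g.IsStronglyCausal τ) (hSC' : g'.IsStronglyCausal τ')
    {ψ : U → M'}
    (hψ : (g.restrict PseudoRiemannianMetric.contMDiff_restrict_holds U).IsIsometricImmersion
      g'.toPseudoRiemannianMetric ψ)
    {Ψ : M → M'} (hΨψ : ∀ (q : M) (hq : q ∈ U), Ψ q = ψ ⟨q, hq⟩)
    (hΨcurve : ∀ (γ : ℝ → M) (s : Set ℝ), g.IsFutureTimelikeCurveOn τ γ s →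
      (∀ t ∈ s, γ t ∈ U) → g'.IsFutureTimelikeCurveOn τ' (Ψ ∘ γ) s)
    {p : M} (hp : p ∈ frontier (U : Set M)) (hpI : p ∈ g.chronologicalFuture τ Sig) {p' : M'}
    (htends : ∀ (γ : ℝ → M) (a b : ℝ), a < b → g.IsFutureTimelikeCurveOn τ γ (Ico a b) →
      (∀ t ∈ Ico a b, γ t ∈ U) → Tendsto γ (𝓝[<] b) (𝓝 p) →
      Tendsto (Ψ ∘ γ) (𝓝[<] b) (𝓝 p')) :
    ∃ (W : Set M) (Φ : M → M'), IsOpen W ∧ p ∈ W ∧ W ⊆ g.chronologicalFuture τ Sig ∧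
      ContMDiffOn (𝓡 d) (𝓡 d) ∞ Φ W ∧ (∀ q ∈ W, ∀ (hq : q ∈ U), Φ q = ψ ⟨q, hq⟩) ∧ Φ p = p' ∧
      Injective (mfderiv (𝓡 d) (𝓡 d) Φ p) ∧
      ∀ q ∈ W, q ∈ frontier (U : Set M) → ∃ γ : ℝ → M,
        g.IsFutureTimelikeCurveOn τ γ (Ico 0 1) ∧ (∀ t ∈ Ico (0 : ℝ) 1, γ t ∈ U) ∧
        Tendsto γ (𝓝[<] 1) (𝓝 q) ∧ Tendsto (Ψ ∘ γ) (𝓝[<] 1) (𝓝 (Φ q)) := by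
  classical
  have hn2 : (2 : ℕ∞ω) ≤ ∞ := WithTop.coe_le_coe.mpr le_top
  have hn1 : (1 : ℕ∞ω) ≤ ∞ := le_trans one_le_two hn2
  haveI : Fact ((1 : ℕ∞ω) ≤ ∞) := ⟨hn1⟩
  haveI := contMDiffCovariantDerivative_leviCivita_infty g.toPseudoRiemannianMetric le_rfl
  haveI := contMDiffCovariantDerivative_leviCivita_infty g'.toPseudoRiemannianMetric le_rfl
  set cov := g.leviCivita with hcov
  set cov' := g'.leviCivita with hcov'
  set gU := g.toPseudoRiemannianMetric.restrict PseudoRiemannianMetric.contMDiff_restrict_holds U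
    with hgU
  have hA : g.IsAchronal τ Sig := IsCauchyHypersurface.isAchronal_holds hn2 hSig
  have hpcl : p ∈ closure (U : Set M) := frontier_subset_closure hp
  have hψ' : gU.IsIsometricImmersion g'.toPseudoRiemannianMetric ψ := hψ
  -- (1) the uniformly normal neighbourhood of `p'` and a causally convex neighbourhood inside it
  obtain ⟨W₁', Src', Ξ', hW₁'o, hp'W₁', hW₁'src, hS'o, hS'0, hS'dom, hinjF', hΞ', hΞ's, -⟩ :=
    exists_twoPoint_expInverse (cov := cov') p'
  obtain ⟨A', hA'o, hp'A', hA'W₁', hA'conv⟩ :=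
    hSC'.exists_causallyConvex_nhds hn1 p' (hW₁'o.mem_nhds hp'W₁')
  -- (2) the uniformly normal neighbourhood of `p` and a causally convex neighbourhood inside it
  obtain ⟨W₁, Src, Ξ, hW₁o, hpW₁, hW₁src, hSo, hS0, hSdom, hinjF, hΞ, hΞs, -⟩ :=
    exists_twoPoint_expInverse (cov := cov) p
  obtain ⟨A, hAo, hpA, hAW₁, hAconv⟩ :=
    hSC.exists_causallyConvex_nhds hn1 p (hW₁o.mem_nhds hpW₁)
  -- (3) a future timelike curve `γ₀` of `U` from a point `o₀ ∈ I⁺(Σ) ∩ I⁻(p)` to `p`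
  obtain ⟨o₀, ho₀I, ho₀p⟩ : (g.chronologicalFuture τ Sig ∩ g.chronologicalPast τ {p}).Nonempty :=
    mem_closure_iff_nhds.1
      (subset_closure_chronologicalFuture (g := g) (τ := τ.reverse) {p} rfl) _
      ((isOpen_chronologicalFuture_of_boundaryless _ _ _).mem_nhds hpI)
  have hpo₀ : p ∈ g.chronologicalFuture τ {o₀} := mem_chronologicalFuture_of_mem_chronologicalPast ho₀p
  have ho₀U : o₀ ∈ U :=
    hA.mem_opens_of_mem_closure_of_mem_chronologicalFuture hn2 _ _ hU
      (chronologicalFuture_subset_causalFuture _ _ _ ho₀I) hpcl hpo₀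
  obtain ⟨x₀, hx₀, γ₀, a, b, hab, hγ₀, hγ₀a, hγ₀b⟩ := hpo₀
  rw [mem_singleton_iff] at hx₀
  subst hx₀
  have hγ₀U : ∀ t ∈ Ico a b, γ₀ t ∈ U := by
    intro t ht
    rcases eq_or_lt_of_le ht.1 with hat | hat
    · rw [← hat, hγ₀a]; exact ho₀U
    · refine hSig.chronologicalFuture_inter_chronologicalPast_subset_opens hn2 _ _ hU
        (q := γ₀ a) (p := γ₀ b) (by rw [hγ₀a]; exact ho₀U) (by rw [hγ₀b]; exact hpcl) ⟨?_, ?_⟩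
      · exact ⟨γ₀ a, rfl, γ₀, a, t, hat, hγ₀.mono (Icc_subset_Icc_right ht.2.le), rfl, rfl⟩
      · exact mem_chronologicalPast_of_mem_chronologicalFuture
          ⟨γ₀ t, rfl, γ₀, t, b, ht.2, hγ₀.mono (Icc_subset_Icc_left ht.1), rfl, rfl⟩
  have hγ₀lim : Tendsto γ₀ (𝓝[<] b) (𝓝 p) := by
    rw [← hγ₀b]
    exact ((hγ₀ b (right_mem_Icc.2 hab.le)).1.continuousAt.continuousWithinAt).tendsto
  have hΨγ₀ : Tendsto (Ψ ∘ γ₀) (𝓝[<] b) (𝓝 p') :=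
    htends γ₀ a b hab (hγ₀.mono Ico_subset_Icc_self) hγ₀U hγ₀lim
  -- the point `o = γ₀ t₀`, close to `p`: in `A`, with `Ψ o ∈ A'`
  obtain ⟨t₀, ⟨ht₀A, ht₀A'⟩, ht₀⟩ : ∃ t₀, (γ₀ t₀ ∈ A ∧ Ψ (γ₀ t₀) ∈ A') ∧ t₀ ∈ Ioo a b := by
    have h1 : ∀ᶠ t in 𝓝[<] b, γ₀ t ∈ A := hγ₀lim (hAo.mem_nhds hpA)
    have h2 : ∀ᶠ t in 𝓝[<] b, Ψ (γ₀ t) ∈ A' := hΨγ₀ (hA'o.mem_nhds hp'A')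
    have h3 : ∀ᶠ t in 𝓝[<] b, t ∈ Ioo a b := Ioo_mem_nhdsLT hab
    exact ((h1.and h2).and h3).exists
  set o : M := γ₀ t₀ with ho_def
  have hoU : o ∈ U := hγ₀U t₀ ⟨ht₀.1.le, ht₀.2⟩
  have hoW₁ : o ∈ W₁ := hAW₁ ht₀A
  have hoI : o ∈ g.chronologicalFuture τ Sig :=
    mem_chronologicalFuture_trans ho₀I
      ⟨γ₀ a, hγ₀a, γ₀, a, t₀, ht₀.1, hγ₀.mono (Icc_subset_Icc_right ht₀.2.le), rfl, rfl⟩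
  have hop : p ∈ g.chronologicalFuture τ {o} :=
    ⟨o, rfl, γ₀, t₀, b, ht₀.2, hγ₀.mono (Icc_subset_Icc_left ht₀.1.le), rfl, hγ₀b⟩
  set o' : M' := ψ ⟨o, hoU⟩ with ho'_def
  have hΨo : Ψ o = o' := hΨψ o hoU
  have ho'A' : o' ∈ A' := by rw [← hΨo]; exact ht₀A'
  have ho'W₁' : o' ∈ W₁' := hA'W₁' ho'A'
  -- (4) the local inverse `K = e⁻¹ ∘ Ξ(o, ·)` of `exp_o` on `W₁`
  set e := trivializationAt (EuclideanSpace ℝ (Fin d)) (TangentSpace (𝓡 d) : M → Type _) p with he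
  have hbase : e.baseSet = (chartAt (EuclideanSpace ℝ (Fin d)) p).source :=
    TangentBundle.trivializationAt_baseSet p
  set L : (EuclideanSpace ℝ (Fin d)) →L[ℝ] (EuclideanSpace ℝ (Fin d)) := e.symmL ℝ o with hL
  set K : M → (EuclideanSpace ℝ (Fin d)) := fun z ↦ L (Ξ o z) with hK
  have hΞos : ContMDiffOn (𝓡 d) 𝓘(ℝ, (EuclideanSpace ℝ (Fin d))) ∞ (fun z ↦ Ξ o z) W₁ := by
    have h1 : ContMDiff (𝓡 d) ((𝓡 d).prod (𝓡 d)) ∞ (fun z : M ↦ (o, z)) :=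
      contMDiff_const.prodMk contMDiff_id
    exact hΞs.comp h1.contMDiffOn fun z hz ↦ ⟨hoW₁, hz⟩
  have hKsm : ContMDiffOn (𝓡 d) 𝓘(ℝ, (EuclideanSpace ℝ (Fin d))) ∞ K W₁ := by
    have hLs : ContMDiff 𝓘(ℝ, (EuclideanSpace ℝ (Fin d))) 𝓘(ℝ, (EuclideanSpace ℝ (Fin d))) ∞
        (fun ξ : (EuclideanSpace ℝ (Fin d)) ↦ L ξ) := L.contMDiff
    exact hLs.comp_contMDiffOn hΞos
  have hKexp : ∀ z ∈ W₁, expMap cov o ((K z : EuclideanSpace ℝ (Fin d)) : TangentSpace (𝓡 d) o) = z := fun z hz ↦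
    (hΞ o hoW₁ z hz).2
  have hKdom : ∀ z ∈ W₁, ((K z : EuclideanSpace ℝ (Fin d)) : TangentSpace (𝓡 d) o) ∈ expDomain cov o := fun z hz ↦
    (hSdom _ (hΞ o hoW₁ z hz).1).2
  have hΞoo : Ξ o o = 0 := by
    have h1' : (o, Ξ o o) ∈ Src := (hΞ o hoW₁ o hoW₁).1
    have h2' : (o, (0 : (EuclideanSpace ℝ (Fin d)))) ∈ Src := hS0 o hoW₁
    have heq : (fun w : M × (EuclideanSpace ℝ (Fin d)) ↦
          (w.1, expMap cov w.1 (e.symmL ℝ w.1 w.2))) (o, Ξ o o) =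
        (fun w : M × (EuclideanSpace ℝ (Fin d)) ↦
          (w.1, expMap cov w.1 (e.symmL ℝ w.1 w.2))) (o, (0 : (EuclideanSpace ℝ (Fin d)))) := by
      show (o, expMap cov o (e.symmL ℝ o (Ξ o o))) = (o, expMap cov o (e.symmL ℝ o 0))
      rw [(hΞ o hoW₁ o hoW₁).2, map_zero, expMap_zero (cov := cov) o]
    exact (Prod.ext_iff.1 (hinjF h1' h2' heq)).2
  have hK0 : K o = 0 := by simp only [hK, hΞoo, map_zero]
  have hKd : ∀ z ∈ W₁, MDifferentiableAt (𝓡 d) 𝓘(ℝ, (EuclideanSpace ℝ (Fin d))) K z := fun z hz ↦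
    (hKsm.contMDiffAt (hW₁o.mem_nhds hz)).mdifferentiableAt (by simp)
  -- (5) the radial vector `X = exp_o⁻¹ p` is future timelike (O'Neill's Lemma 5.33 along `γ₀`)
  set X : (EuclideanSpace ℝ (Fin d)) := K p with hX
  have hγ₀W₁ : ∀ t ∈ Icc t₀ b, γ₀ t ∈ W₁ := fun t ht ↦
    hAW₁ (hAconv γ₀ t₀ b ht₀.2.le
      (hγ₀.isFutureCausalCurveOn.mono (Icc_subset_Icc_left ht₀.1.le)) ht₀A
      (by rw [hγ₀b]; exact hpA) ht)
  have hXC : g.IsTimelike (x := o) X ∧ τ.IsFutureDirected (x := o) X := by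
    have h := isTimelike_expInverse_of_curve τ hW₁o hoW₁ hKsm hK0 hKexp hKdom ht₀.2
      (hγ₀.mono (Icc_subset_Icc_left ht₀.1.le)) rfl hγ₀W₁
    rw [hγ₀b] at h
    exact h
  have hXdom : ((X : EuclideanSpace ℝ (Fin d)) : TangentSpace (𝓡 d) o) ∈ expDomain cov o := hKdom p hpW₁
  have hXexp : expMap cov o ((X : EuclideanSpace ℝ (Fin d)) : TangentSpace (𝓡 d) o) = p := hKexp p hpW₁
  -- (6) radial geodesics from `o` in future timelike directions ending in `Ū` run in `U`,
  -- and `ψ` carries them to the radial geodesics of `M'` from `o' = ψ o`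
  have hray := fun (Z : EuclideanSpace ℝ (Fin d)) (hZt : g.IsTimelike (x := o) Z)
      (hZf : τ.IsFutureDirected (x := o) Z) ↦
    radial_mem_opens_of_mem_closure τ U hSig hU hoU hZt hZf
  set T : (EuclideanSpace ℝ (Fin d)) →L[ℝ] (EuclideanSpace ℝ (Fin d)) :=
    mfderiv (𝓡 d) (𝓡 d) ψ ⟨o, hoU⟩ with hT
  have hrayψ := fun (Z : EuclideanSpace ℝ (Fin d))
      (hZdom : ∀ r ∈ Icc (0 : ℝ) 1,
        ((r • Z : EuclideanSpace ℝ (Fin d)) : TangentSpace (𝓡 d) o) ∈ expDomain cov o)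
      (r : ℝ) (hr : r ∈ Icc (0 : ℝ) 1) ↦
    expMap_smul_mfderiv_eq (g' := g') U hψ hΨψ hoU hZdom hr
  -- (7) the radial geodesic `c` from `o` to `p`, in `U` before `p`; `Ψ ∘ c → p'`
  obtain ⟨hcdom, hccurve, hcU, hccont⟩ := hray X hXC.1 hXC.2 hXdom (by rw [hXexp]; exact hpcl)
  set c : ℝ → M := fun r ↦ expMap cov o ((r • X : EuclideanSpace ℝ (Fin d)) : TangentSpace (𝓡 d) o) with hc
  have hc0 : c 0 = o := by simp only [hc, zero_smul]; exact expMap_zero (cov := cov) o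
  have hc1 : c 1 = p := by simp only [hc, one_smul]; exact hXexp
  have hclim : Tendsto c (𝓝[<] 1) (𝓝 p) := by
    rw [← hc1]
    exact hccont.continuousWithinAt.tendsto
  have hΨc : Tendsto (Ψ ∘ c) (𝓝[<] 1) (𝓝 p') :=
    htends c 0 1 zero_lt_one (hccurve.mono Ico_subset_Icc_self) hcU hclim
  -- (8) `Ψ ∘ c` stays in the causally convex neighbourhood `A'` of `p'`
  have hcA' : ∀ r ∈ Ico (0 : ℝ) 1, Ψ (c r) ∈ A' := by
    intro r hr
    have h1 : ∀ᶠ s in 𝓝[<] (1 : ℝ), Ψ (c s) ∈ A' := hΨc (hA'o.mem_nhds hp'A')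
    have h2 : ∀ᶠ s in 𝓝[<] (1 : ℝ), s ∈ Ico r 1 := Ico_mem_nhdsLT hr.2
    obtain ⟨r₁, hr₁A', hr₁⟩ : ∃ r₁, Ψ (c r₁) ∈ A' ∧ r₁ ∈ Ico r 1 := (h1.and h2).exists
    have hcurve' : g'.IsFutureTimelikeCurveOn τ' (Ψ ∘ c) (Icc 0 r₁) :=
      hΨcurve _ _ (hccurve.mono (Icc_subset_Icc_right hr₁.2.le))
        (fun t ht ↦ hcU t ⟨ht.1, ht.2.trans_lt hr₁.2⟩)
    exact hA'conv (Ψ ∘ c) 0 r₁ (hr.1.trans hr₁.1) hcurve'.isFutureCausalCurveOn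
      (by show Ψ (c 0) ∈ A'; rw [hc0, hΨo]; exact ho'A') hr₁A' ⟨hr.1, hr₁.1⟩
  -- (9) hence `X' = dψ_o X` exponentiates to `p'` (continuity in the normal neighbourhood of `p'`)
  set X' : TangentSpace (𝓡 d) o' := T X with hX'
  have hX'r : ∀ r ∈ Ico (0 : ℝ) 1,
      r • X' ∈ expDomain cov' o' ∧ expMap cov' o' (r • X') = Ψ (c r) :=
    fun r hr ↦ hrayψ X hcdom r ⟨hr.1, hr.2.le⟩ (fun t ht ↦ hcU t ⟨ht.1, ht.2.trans_lt hr.2⟩)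
  have hlim' : Tendsto (fun r : ℝ ↦ expMap cov' o' (r • X')) (𝓝[<] 1) (𝓝 p') := by
    refine hΨc.congr' ?_
    filter_upwards [Ico_mem_nhdsLT zero_lt_one] with r hr
    exact ((hX'r r hr).2).symm
  have hcW₁' : ∀ r ∈ Ico (0 : ℝ) 1, expMap cov' o' (r • X') ∈ W₁' := fun r hr ↦ by
    rw [(hX'r r hr).2]; exact hA'W₁' (hcA' r hr)
  obtain ⟨hΞ'X', -, hX'dom, hX'exp⟩ :=
    twoPoint_expInverse_eq_of_tendsto_radial (cov := cov') p' hW₁'o hW₁'src hS'o hS'0 hS'dom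
      hinjF' hΞ' hΞ's ho'W₁' X' (fun r hr ↦ (hX'r r hr).1) hcW₁' hp'W₁' hlim'
  -- (10) the extension `Φ = exp_{o'} ∘ dψ_o ∘ exp_o⁻¹` and the neighbourhood `W`
  let F : (EuclideanSpace ℝ (Fin d)) → M' := fun u ↦
    expMap cov' o' ((T u : EuclideanSpace ℝ (Fin d)) : TangentSpace (𝓡 d) o')
  let Φ : M → M' := fun q ↦ F (K q)
  let C : Set (EuclideanSpace ℝ (Fin d)) :=
    {v : (EuclideanSpace ℝ (Fin d)) | g.IsTimelike (x := o) v ∧ τ.IsFutureDirected (x := o) v}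
  have hCo : IsOpen C := τ.isOpen_setOf_isTimelike_and_isFutureDirected o
  let Dm : Set (EuclideanSpace ℝ (Fin d)) :=
    {v : (EuclideanSpace ℝ (Fin d)) | (v : TangentSpace (𝓡 d) o') ∈ expDomain cov' o'}
  have hDmo : IsOpen Dm := isOpen_expDomain (cov := cov') (k := 1) le_rfl o'
  let G : Set (EuclideanSpace ℝ (Fin d)) := C ∩ T ⁻¹' Dm
  have hGo : IsOpen G := hCo.inter (hDmo.preimage T.continuous)
  let W : Set M := W₁ ∩ K ⁻¹' G ∩ g.chronologicalFuture τ Sig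
  have hWo : IsOpen W :=
    (hKsm.continuousOn.isOpen_inter_preimage hW₁o hGo).inter
      (isOpen_chronologicalFuture_of_boundaryless _ _ _)
  have hpW : p ∈ W := ⟨⟨hpW₁, hXC, hX'dom⟩, hpI⟩
  -- (11) `Φ` is smooth on `W`
  have hFs : ContMDiffOn 𝓘(ℝ, EuclideanSpace ℝ (Fin d)) (𝓡 d) ∞ F (T ⁻¹' Dm) := by
    have hexp's : ContMDiffOn 𝓘(ℝ, EuclideanSpace ℝ (Fin d)) (𝓡 d) ∞
        (fun v : EuclideanSpace ℝ (Fin d) ↦ expMap cov' o' (v : TangentSpace (𝓡 d) o')) Dm :=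
      contMDiffOn_expMap (cov := cov') (k := (⊤ : ℕ∞)) le_top o'
    exact hexp's.comp T.contMDiff.contMDiffOn fun u hu ↦ hu
  have hΦs : ContMDiffOn (𝓡 d) (𝓡 d) ∞ Φ W :=
    hFs.comp (hKsm.mono fun q hq ↦ hq.1.1) fun q hq ↦ hq.1.2.2
  -- (12)–(13) `Φ p = p'` and `Φ = ψ` on `W ∩ U`
  have hΦp : Φ p = p' := hX'exp
  have hΦψ : ∀ q ∈ W, ∀ (hq : q ∈ U), Φ q = ψ ⟨q, hq⟩ := by
    intro q hqW hq
    have hqW₁ : q ∈ W₁ := hqW.1.1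
    have hZC : K q ∈ C := hqW.1.2.1
    have hZexp : expMap cov o (K q : TangentSpace (𝓡 d) o) = q := hKexp q hqW₁
    obtain ⟨hZr, -, hZU, -⟩ := hray (K q) hZC.1 hZC.2 (hKdom q hqW₁)
      (by rw [hZexp]; exact subset_closure hq)
    have h := (hrayψ (K q) hZr 1 ⟨zero_le_one, le_rfl⟩ (fun t ht ↦ by
      rcases ht.2.eq_or_lt with h1 | h1
      · rw [h1, one_smul, hZexp]; exact hq
      · exact hZU t ⟨ht.1, h1⟩)).2
    rw [one_smul, one_smul, hZexp, hΨψ q hq] at h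
    exact h
  -- (14) `dΦ_p` is injective
  have hinj : Injective (mfderiv (𝓡 d) (𝓡 d) Φ p) := by
    -- `dK_p` is injective: `exp_o ∘ K = id` near `p`
    let expo : (EuclideanSpace ℝ (Fin d)) → M := fun u ↦ expMap cov o (u : TangentSpace (𝓡 d) o)
    have hexpd : MDifferentiableAt 𝓘(ℝ, EuclideanSpace ℝ (Fin d)) (𝓡 d) expo (K p) :=
      mdifferentiableAt_expMap_of_mem (cov := cov) o hXdom
    have hKdp : MDifferentiableAt (𝓡 d) 𝓘(ℝ, EuclideanSpace ℝ (Fin d)) K p := hKd p hpW₁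
    have hevK : (expo ∘ K) =ᶠ[𝓝 p] id := by
      filter_upwards [hW₁o.mem_nhds hpW₁] with z hz using hKexp z hz
    have hKinj : Injective (mfderiv (𝓡 d) 𝓘(ℝ, EuclideanSpace ℝ (Fin d)) K p) :=
      (injective_mfderiv_of_comp_eventuallyEq_id hKdp hexpd hevK).1
    -- `d(exp_{o'})_{X'}` is injective: it is surjective, as `exp_{o'} ∘ K' = id` near `p'`
    let e' := trivializationAt (EuclideanSpace ℝ (Fin d)) (TangentSpace (𝓡 d) : M' → Type _) p'
    have hbase' : e'.baseSet = (chartAt (EuclideanSpace ℝ (Fin d)) p').source :=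
      TangentBundle.trivializationAt_baseSet p'
    have ho'e' : o' ∈ e'.baseSet := by rw [hbase']; exact hW₁'src ho'W₁'
    let L' : (EuclideanSpace ℝ (Fin d)) →L[ℝ] (EuclideanSpace ℝ (Fin d)) := e'.symmL ℝ o'
    let K' : M' → (EuclideanSpace ℝ (Fin d)) := fun z ↦ L' (Ξ' o' z)
    have hK's : ContMDiffOn (𝓡 d) 𝓘(ℝ, (EuclideanSpace ℝ (Fin d))) ∞ K' W₁' := by
      have h1 : ContMDiff (𝓡 d) ((𝓡 d).prod (𝓡 d)) ∞ (fun z : M' ↦ (o', z)) :=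
        contMDiff_const.prodMk contMDiff_id
      have h2 : ContMDiffOn (𝓡 d) 𝓘(ℝ, (EuclideanSpace ℝ (Fin d))) ∞ (fun z ↦ Ξ' o' z) W₁' :=
        hΞ's.comp h1.contMDiffOn fun z hz ↦ ⟨ho'W₁', hz⟩
      exact L'.contMDiff.comp_contMDiffOn h2
    have hK'p' : K' p' = X' := by
      show e'.symmL ℝ o' (Ξ' o' p') = X'
      rw [hΞ'X']
      exact e'.symmL_continuousLinearMapAt ho'e' X'
    let expo' : (EuclideanSpace ℝ (Fin d)) → M' :=
      fun u ↦ expMap cov' o' (u : TangentSpace (𝓡 d) o')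
    have hexpd' : MDifferentiableAt 𝓘(ℝ, EuclideanSpace ℝ (Fin d)) (𝓡 d) expo' X' :=
      mdifferentiableAt_expMap_of_mem (cov := cov') o' hX'dom
    have hexpd'' : MDifferentiableAt 𝓘(ℝ, EuclideanSpace ℝ (Fin d)) (𝓡 d) expo' (K' p') := by
      rw [hK'p']; exact hexpd'
    have hK'd : MDifferentiableAt (𝓡 d) 𝓘(ℝ, EuclideanSpace ℝ (Fin d)) K' p' :=
      (hK's.contMDiffAt (hW₁'o.mem_nhds hp'W₁')).mdifferentiableAt (by simp)
    have hevK' : (expo' ∘ K') =ᶠ[𝓝 p'] id := by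
      filter_upwards [hW₁'o.mem_nhds hp'W₁'] with z hz using (hΞ' o' ho'W₁' z hz).2
    have hexpinj : Injective (mfderiv 𝓘(ℝ, EuclideanSpace ℝ (Fin d)) (𝓡 d) expo' X') := by
      have h := (injective_mfderiv_of_comp_eventuallyEq_id hK'd hexpd'' hevK').2
      rw [hK'p'] at h
      exact injective_of_surjective_clm h
    -- `T = dψ_o` is injective, and the chain rule
    have hTinj : Injective T := hψ'.injective_mfderiv ⟨o, hoU⟩
    have hTd : HasMFDerivAt 𝓘(ℝ, EuclideanSpace ℝ (Fin d)) 𝓘(ℝ, EuclideanSpace ℝ (Fin d))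
        (fun u : EuclideanSpace ℝ (Fin d) ↦ T u) X T := T.hasMFDerivAt
    have hFd : MDifferentiableAt 𝓘(ℝ, EuclideanSpace ℝ (Fin d)) (𝓡 d) F X :=
      hexpd'.comp X hTd.mdifferentiableAt
    have hFeq : mfderiv 𝓘(ℝ, EuclideanSpace ℝ (Fin d)) (𝓡 d) F X =
        (mfderiv 𝓘(ℝ, EuclideanSpace ℝ (Fin d)) (𝓡 d) expo' X').comp T := by
      rw [show F = expo' ∘ (fun u : EuclideanSpace ℝ (Fin d) ↦ T u) from rfl,
        mfderiv_comp X (g := expo') (f := fun u : EuclideanSpace ℝ (Fin d) ↦ T u) hexpd'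
          hTd.mdifferentiableAt, hTd.mfderiv]
      rfl
    have hFinj : Injective (mfderiv 𝓘(ℝ, EuclideanSpace ℝ (Fin d)) (𝓡 d) F X) := by
      rw [hFeq]
      exact hexpinj.comp hTinj
    have hΦeq : mfderiv (𝓡 d) (𝓡 d) Φ p =
        (mfderiv 𝓘(ℝ, EuclideanSpace ℝ (Fin d)) (𝓡 d) F X).comp
          (mfderiv (𝓡 d) 𝓘(ℝ, EuclideanSpace ℝ (Fin d)) K p) := by
      rw [show Φ = F ∘ K from rfl, mfderiv_comp p (g := F) (f := K) hFd hKdp]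
    rw [hΦeq]
    exact hFinj.comp hKinj
  -- (15) the boundary points of `W` correspond to their images under `Φ`
  refine ⟨W, Φ, hWo, hpW, fun q hq ↦ hq.2, hΦs, hΦψ, hΦp, hinj, fun q hqW hqfr ↦ ?_⟩
  have hqW₁ : q ∈ W₁ := hqW.1.1
  have hZC : K q ∈ C := hqW.1.2.1
  have hZD : ((T (K q) : EuclideanSpace ℝ (Fin d)) : TangentSpace (𝓡 d) o') ∈ expDomain cov' o' :=
    hqW.1.2.2
  have hZexp : expMap cov o (K q : TangentSpace (𝓡 d) o) = q := hKexp q hqW₁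
  obtain ⟨hZr, hZcurve, hZU, hZcont⟩ := hray (K q) hZC.1 hZC.2 (hKdom q hqW₁)
    (by rw [hZexp]; exact frontier_subset_closure hqfr)
  let γ : ℝ → M := fun r ↦
    expMap cov o ((r • K q : EuclideanSpace ℝ (Fin d)) : TangentSpace (𝓡 d) o)
  have hγ1 : γ 1 = q := by simp only [γ, one_smul]; exact hZexp
  have hΨγ : ∀ r ∈ Ico (0 : ℝ) 1,
      expMap cov' o' ((r • T (K q) : EuclideanSpace ℝ (Fin d)) : TangentSpace (𝓡 d) o') = Ψ (γ r) :=
    fun r hr ↦ (hrayψ (K q) hZr r ⟨hr.1, hr.2.le⟩ (fun t ht ↦ hZU t ⟨ht.1, ht.2.trans_lt hr.2⟩)).2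
  refine ⟨γ, hZcurve.mono Ico_subset_Icc_self, hZU, ?_, ?_⟩
  · rw [← hγ1]
    exact hZcont.continuousWithinAt.tendsto
  · -- `Ψ ∘ γ` is the radial geodesic of `M'` from `o'` with velocity `T (K q)`, continuous at `1`
    obtain ⟨hmax', h0D', -, -⟩ := maximalGeodesic_spec' (cov := cov') o'
      ((T (K q) : EuclideanSpace ℝ (Fin d)) : TangentSpace (𝓡 d) o')
    have h1D' : (1 : ℝ) ∈ maximalGeodesicDomain cov' o'
        ((T (K q) : EuclideanSpace ℝ (Fin d)) : TangentSpace (𝓡 d) o') := hZD.2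
    have hcont' : ContinuousAt (fun r : ℝ ↦ expMap cov' o'
        ((r • T (K q) : EuclideanSpace ℝ (Fin d)) : TangentSpace (𝓡 d) o')) 1 :=
      (IsGeodesicOn.mdifferentiableAt_holds (isGeodesicOn_expMap_smul (cov := cov') o'
        ((T (K q) : EuclideanSpace ℝ (Fin d)) : TangentSpace (𝓡 d) o')) h1D').continuousAt
    have hlim1 : Tendsto (fun r : ℝ ↦ expMap cov' o'
        ((r • T (K q) : EuclideanSpace ℝ (Fin d)) : TangentSpace (𝓡 d) o')) (𝓝[<] 1) (𝓝 (Φ q)) := by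
      have h := hcont'.tendsto.mono_left (nhdsWithin_le_nhds (s := Iio (1 : ℝ)))
      simp only [one_smul] at h
      exact h
    refine hlim1.congr' ?_
    filter_upwards [Ico_mem_nhdsLT zero_lt_one] with r hr using hΨγ r hr

end LorentzianMetric

end Core

end Literature.Geometry.Lorentzian

end
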